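import Mathlib
import Literature.MathematicalPhysics.QuantumFieldTheory.LaportaRemiddi1996.AnalyticCoefficients

/-!
# Log-power integrals on `[0,1]`: `∫ uⁿ logᵏu`, `∫ logᵏ(1−x)`, `∫ x·logᵏ(1−x)`, `∫ x⁻¹ logᵏ(1−x) = (−1)ᵏ k! ζ(k+1)`

HONEST FRAMING: independent recomputation; certified where stated, statistical where stated; no new-physics claim.

Cell `pub-qed` (venture `QEDPrecision`), unit `pub-qed-lit`, Route D of item 'I(a)-CERT': the calculus behind the
kernel evaluation, in closed form, of Jegerlehner's sequential-insertion integrals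
`vpChain n 1 = ∫₀¹ (1−x) (−Π₂(s_x))ⁿ dx` (`Literature…Jegerlehner2017.vpChain`; n = 2 is the sixth-order
"double bubble", see `DoubleBubble.lean`). This file holds standard real-analysis lemmas (folklore), proved
from Mathlib; nothing here is specific to QED and there are no new definitions:
* `integral_pow_mul_log_pow`: `∫₀¹ uⁿ (log u)ᵏ du = (−1)ᵏ k!/(n+1)^{k+1}` (by parts, induction on `k`);
* `integral_log_one_sub_pow`, `integral_id_mul_log_one_sub_pow`: `∫₀¹ logᵏ(1−x) dx = (−1)ᵏ k!` and
  `∫₀¹ x logᵏ(1−x) dx = (−1)ᵏ k! (1 − 1/2^{k+1})`;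
* `integral_inv_mul_log_one_sub_pow`: `∫₀¹ x⁻¹ logᵏ(1−x) dx = (−1)ᵏ k! Σ_{n≥0} 1/(n+1)^{k+1}` for `k ≥ 1`
  (geometric series and `hasSum_integral_of_summable_integral_norm`), and `tsum_inv_succ_pow_eq_zeta`
  identifying that sum with the tree's `LaportaRemiddi1996.zeta (k+1) = Σ' 1/n^{k+1}`;
together with the integrability statements they need (`|log u|ᵏ ≤ (2k)ᵏ u^{−1/2}` on `(0,1]`).
-/

noncomputable section

open Real Set MeasureTheory intervalIntegral Filter Topology

namespace Summit.Ventures.QEDPrecision.BubbleChains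

open Literature.MathematicalPhysics.QuantumFieldTheory.LaportaRemiddi1996 (zeta)

/-! ## `uⁿ (log u)ᵏ` on `[0,1]` -/

/-- `u · (log u)^k → 0` as `u → 0⁺`. [folklore] -/
theorem tendsto_self_mul_log_pow (k : ℕ) :
    Tendsto (fun u : ℝ => u * log u ^ k) (𝓝[>] 0) (𝓝 0) := by
  rcases Nat.eq_zero_or_pos k with hk | hk
  · subst hk
    simpa using (tendsto_nhdsWithin_of_tendsto_nhds (continuous_id.tendsto (0:ℝ)) :
      Tendsto (fun u : ℝ => u) (𝓝[>] 0) (𝓝 0))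
  · have hr : (0:ℝ) < 1 / k := by positivity
    have h := (tendsto_log_mul_rpow_nhdsGT_zero hr).pow k
    rw [zero_pow hk.ne'] at h
    refine h.congr' ?_
    filter_upwards [self_mem_nhdsWithin] with u hu
    have hu' : (0:ℝ) ≤ u := le_of_lt hu
    have key : (u ^ (1 / (k:ℝ))) ^ k = u := by
      rw [← rpow_natCast (u ^ (1 / (k:ℝ))) k, ← rpow_mul hu']
      rw [one_div_mul_cancel (by exact_mod_cast hk.ne'), rpow_one]
    rw [mul_pow, key, mul_comm]

/-- `u^(n+1) · (log u)^k → 0` as `u → 0⁺`. [folklore] -/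
theorem tendsto_pow_succ_mul_log_pow (n k : ℕ) :
    Tendsto (fun u : ℝ => u ^ (n + 1) * log u ^ k) (𝓝[>] 0) (𝓝 0) := by
  have h1 := tendsto_self_mul_log_pow k
  have h2 : Tendsto (fun u : ℝ => u ^ n) (𝓝[>] 0) (𝓝 (0 ^ n)) :=
    tendsto_nhdsWithin_of_tendsto_nhds ((continuous_pow n).tendsto 0)
  have := h2.mul h1
  simp only [mul_zero] at this
  refine this.congr' (Eventually.of_forall fun u => ?_)
  simp only; ring

/-- `|log u|^k ≤ (2k)^k · u^(-1/2)` on `(0,1]` (for `k ≥ 1`). [folklore] -/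
theorem abs_log_pow_le (k : ℕ) (hk : 0 < k) {u : ℝ} (h0 : 0 < u) (h1 : u ≤ 1) :
    |log u| ^ k ≤ (2 * k) ^ k * u ^ (-(1/2 : ℝ)) := by
  have ht : (0:ℝ) < 1 / (2 * k) := by positivity
  have h := abs_log_mul_self_rpow_lt u (1 / (2 * k)) h0 h1 ht
  rw [abs_mul, abs_of_pos (rpow_pos_of_pos h0 _)] at h
  have hu : 0 < u ^ (1 / (2 * (k:ℝ))) := rpow_pos_of_pos h0 _
  -- |log u| < (1/t) · u^{-t}
  have hlog : |log u| ≤ (2 * k) * u ^ (-(1 / (2 * (k:ℝ)))) := by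
    rw [rpow_neg h0.le]
    have : |log u| * u ^ (1 / (2 * (k:ℝ))) ≤ 2 * k := by
      have := h.le; rw [one_div_one_div] at this; exact this
    calc |log u| = |log u| * u ^ (1 / (2 * (k:ℝ))) * (u ^ (1 / (2 * (k:ℝ))))⁻¹ := by
            field_simp
      _ ≤ 2 * k * (u ^ (1 / (2 * (k:ℝ))))⁻¹ := by gcongr
  calc |log u| ^ k ≤ ((2 * k) * u ^ (-(1 / (2 * (k:ℝ))))) ^ k := by
        gcongr
    _ = (2 * k) ^ k * u ^ (-(1/2 : ℝ)) := by
        rw [mul_pow, ← rpow_natCast (u ^ _), ← rpow_mul h0.le]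
        congr 2
        field_simp

/-- `(log u)^k` is integrable on `[0,1]`. [folklore] -/
theorem intervalIntegrable_log_pow (k : ℕ) :
    IntervalIntegrable (fun u : ℝ => log u ^ k) volume 0 1 := by
  rcases Nat.eq_zero_or_pos k with hk | hk
  · subst hk; simp
  have hg : IntervalIntegrable (fun u : ℝ => (2 * (k:ℝ)) ^ k * u ^ (-(1/2 : ℝ))) volume 0 1 :=
    (intervalIntegral.intervalIntegrable_rpow' (by norm_num)).const_mul _
  refine hg.mono_fun' ?_ ?_
  · exact ((measurable_log.pow_const k).aestronglyMeasurable)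
  · rw [uIoc_of_le zero_le_one]
    refine (ae_restrict_mem measurableSet_Ioc).mono fun u hu => ?_
    simp only [norm_pow, norm_eq_abs]
    exact abs_log_pow_le k hk hu.1 hu.2

/-- `uⁿ (log u)^k` is integrable on `[0,1]`. [folklore] -/
theorem intervalIntegrable_pow_mul_log_pow (n k : ℕ) :
    IntervalIntegrable (fun u : ℝ => u ^ n * log u ^ k) volume 0 1 :=
  (intervalIntegrable_log_pow k).continuousOn_mul (continuous_pow n).continuousOn

/-- `∫₀¹ uⁿ (log u)^k du = (−1)^k k!/(n+1)^(k+1)`. [folklore] -/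
theorem integral_pow_mul_log_pow (n k : ℕ) :
    ∫ u in (0:ℝ)..1, u ^ n * log u ^ k = (-1) ^ k * k.factorial / ((n:ℝ) + 1) ^ (k + 1) := by
  induction k with
  | zero => simp [integral_pow]
  | succ k ih =>
    -- integrate by parts with G(u) = u^(n+1) (log u)^(k+1) / (n+1)
    have hn : (n:ℝ) + 1 ≠ 0 := by positivity
    have hderiv : ∀ u ∈ Ioo (0:ℝ) 1,
        HasDerivAt (fun u : ℝ => u ^ (n + 1) * log u ^ (k + 1) / ((n:ℝ) + 1))
          (u ^ n * log u ^ (k + 1) + ((k:ℝ) + 1) / ((n:ℝ) + 1) * (u ^ n * log u ^ k)) u := by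
      intro u hu
      have hu0 : u ≠ 0 := hu.1.ne'
      have h := ((hasDerivAt_pow (n + 1) u).mul ((Real.hasDerivAt_log hu0).pow (k + 1))).div_const
        ((n:ℝ) + 1)
      refine h.congr_deriv ?_
      simp only [Pi.pow_apply]
      push_cast [Nat.add_sub_cancel]
      field_simp
      ring
    have hint : IntervalIntegrable (fun u : ℝ =>
        u ^ n * log u ^ (k + 1) + ((k:ℝ) + 1) / ((n:ℝ) + 1) * (u ^ n * log u ^ k)) volume 0 1 :=
      (intervalIntegrable_pow_mul_log_pow n (k + 1)).add
        ((intervalIntegrable_pow_mul_log_pow n k).const_mul _)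
    have h0 : Tendsto (fun u : ℝ => u ^ (n + 1) * log u ^ (k + 1) / ((n:ℝ) + 1)) (𝓝[>] 0) (𝓝 0) :=
        by
      simpa using (tendsto_pow_succ_mul_log_pow n (k + 1)).div_const ((n:ℝ) + 1)
    have h1 : Tendsto (fun u : ℝ => u ^ (n + 1) * log u ^ (k + 1) / ((n:ℝ) + 1)) (𝓝[<] 1) (𝓝 0) :=
        by
      have hc : ContinuousAt (fun u : ℝ => u ^ (n + 1) * log u ^ (k + 1) / ((n:ℝ) + 1)) 1 :=
        (((continuousAt_id.pow _).mul ((continuousAt_log one_ne_zero).pow _)).div_const _)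
      have := hc.tendsto
      simp only [one_pow, log_one, ne_eq, Nat.add_one_ne_zero, not_false_eq_true, zero_pow,
        mul_zero, zero_div] at this
      exact tendsto_nhdsWithin_of_tendsto_nhds this
    have hftc := integral_eq_sub_of_hasDerivAt_of_tendsto zero_lt_one hderiv hint h0 h1
    rw [integral_add (intervalIntegrable_pow_mul_log_pow n (k + 1))
      ((intervalIntegrable_pow_mul_log_pow n k).const_mul _), intervalIntegral.integral_const_mul,
          ih] at hftc
    simp only [sub_zero] at hftc
    have : ∫ u in (0:ℝ)..1, u ^ n * log u ^ (k + 1)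
        = -(((k:ℝ) + 1) / ((n:ℝ) + 1) * ((-1) ^ k * k.factorial / ((n:ℝ) + 1) ^ (k + 1))) := by
      linarith
    rw [this]
    push_cast [Nat.factorial_succ]
    field_simp
    ring

/-! ## `logᵏ(1−x)`, `x logᵏ(1−x)`, `x⁻¹ logᵏ(1−x)` on `[0,1]` -/

/-- `(log (1−x))^k` is integrable on `[0,1]`. [folklore] -/
theorem intervalIntegrable_log_one_sub_pow (k : ℕ) :
    IntervalIntegrable (fun x : ℝ => log (1 - x) ^ k) volume 0 1 := by
  have h := (intervalIntegrable_log_pow k).comp_sub_left 1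
  simp only [sub_zero, sub_self] at h
  exact h.symm

/-- `∫₀¹ (log (1−x))^k dx = (−1)^k k!`. [folklore] -/
theorem integral_log_one_sub_pow (k : ℕ) :
    ∫ x in (0:ℝ)..1, log (1 - x) ^ k = (-1) ^ k * k.factorial := by
  have h := intervalIntegral.integral_comp_sub_left (fun u : ℝ => log u ^ k) (a := 0) (b := 1) 1
  simp only [sub_self, sub_zero] at h
  rw [h]
  have := integral_pow_mul_log_pow 0 k
  simp only [pow_zero, one_mul, CharP.cast_eq_zero, zero_add, one_pow, div_one] at this
  exact this

/-- `∫₀¹ x (log (1−x))^k dx = (−1)^k k! (1 − 1/2^{k+1})`. [folklore] -/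
theorem integral_id_mul_log_one_sub_pow (k : ℕ) :
    ∫ x in (0:ℝ)..1, x * log (1 - x) ^ k = (-1) ^ k * k.factorial * (1 - 1 / 2 ^ (k + 1)) := by
  have h := intervalIntegral.integral_comp_sub_left (fun u : ℝ => (1 - u) * log u ^ k) (a := 0) (b
      := 1) 1
  simp only [sub_sub_cancel, sub_self, sub_zero] at h
  rw [h]
  have e : (fun u : ℝ => (1 - u) * log u ^ k) = fun u => u ^ 0 * log u ^ k - u ^ 1 * log u ^ k := by
    funext u; ring
  rw [e, intervalIntegral.integral_sub (intervalIntegrable_pow_mul_log_pow 0 k)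
    (intervalIntegrable_pow_mul_log_pow 1 k), integral_pow_mul_log_pow, integral_pow_mul_log_pow]
  push_cast
  ring

/-- `|log (1−x)| ≤ x/(1−x)` on `[0,1)`. [folklore] -/
theorem abs_log_one_sub_le {x : ℝ} (hx0 : 0 ≤ x) (hx1 : x < 1) : |log (1 - x)| ≤ x / (1 - x) := by
  have h := Real.abs_log_sub_add_sum_range_le (show |x| < 1 by rw [abs_of_nonneg hx0]; exact hx1) 0
  simp only [Finset.range_zero, Finset.sum_empty, zero_add, pow_one] at h
  rwa [abs_of_nonneg hx0] at h

/-- `x⁻¹ (log (1−x))^k` is integrable on `[0,1]` for `k ≥ 1`. [folklore] -/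
theorem intervalIntegrable_inv_mul_log_one_sub_pow (k : ℕ) (hk : 1 ≤ k) :
    IntervalIntegrable (fun x : ℝ => x⁻¹ * log (1 - x) ^ k) volume 0 1 := by
  have hg : IntervalIntegrable (fun x : ℝ => 2 * (‖log (1 - x) ^ (k - 1)‖ + ‖log (1 - x) ^ k‖))
      volume 0 1 :=
    (((intervalIntegrable_log_one_sub_pow (k - 1)).norm).add
      ((intervalIntegrable_log_one_sub_pow k).norm)).const_mul 2
  refine hg.mono_fun' ?_ ?_
  · exact (measurable_inv.mul ((measurable_log.comp (measurable_const.sub measurable_id)).pow_const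
      k)).aestronglyMeasurable
  · rw [uIoc_of_le zero_le_one]
    refine (ae_restrict_mem measurableSet_Ioc).mono fun x hx => ?_
    simp only [norm_mul, norm_inv, norm_pow, Real.norm_eq_abs]
    rcases eq_or_lt_of_le hx.2 with h1 | h1
    · subst h1
      have : (1:ℕ) ≤ k := hk
      simp [zero_pow (by omega : k ≠ 0)]
    have hxpos : 0 < x := hx.1
    rw [abs_of_pos hxpos]
    have hL : |log (1 - x)| ≤ x / (1 - x) := abs_log_one_sub_le hxpos.le h1
    have hk' : k = (k - 1) + 1 := by omega
    rcases le_or_gt x (1/2) with hle | hgt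
    · -- |L|^k / x = |L|^(k-1) * (|L|/x) ≤ |L|^(k-1) * 2
      have h2 : |log (1 - x)| / x ≤ 2 := by
        rw [div_le_iff₀ hxpos]
        calc |log (1 - x)| ≤ x / (1 - x) := hL
          _ ≤ 2 * x := by
            rw [div_le_iff₀ (by linarith)]; nlinarith
      calc x⁻¹ * |log (1 - x)| ^ k = |log (1 - x)| ^ (k - 1) * (|log (1 - x)| / x) := by
            conv_lhs => rw [hk']
            rw [pow_succ]; field_simp
        _ ≤ |log (1 - x)| ^ (k - 1) * 2 := by gcongr
        _ ≤ 2 * (|log (1 - x)| ^ (k - 1) + |log (1 - x)| ^ k) := by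
            nlinarith [pow_nonneg (abs_nonneg (log (1 - x))) (k - 1),
              pow_nonneg (abs_nonneg (log (1 - x))) k]
    · have h2 : x⁻¹ ≤ 2 := by
        rw [inv_le_comm₀ hxpos (by norm_num)]; linarith
      calc x⁻¹ * |log (1 - x)| ^ k ≤ 2 * |log (1 - x)| ^ k := by gcongr
        _ ≤ 2 * (|log (1 - x)| ^ (k - 1) + |log (1 - x)| ^ k) := by
            nlinarith [pow_nonneg (abs_nonneg (log (1 - x))) (k - 1)]

/-- **`∫₀¹ x⁻¹ (log (1−x))^k dx = (−1)^k k! ζ(k+1)`** (`k ≥ 1`; `ζ(k+1) = Σ_{n≥0} 1/(n+1)^{k+1}`),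
by expanding `1/(1−u)` and integrating termwise (summable integral norms). [folklore] -/
theorem integral_inv_mul_log_one_sub_pow (k : ℕ) (hk : 1 ≤ k) :
    ∫ x in (0:ℝ)..1, x⁻¹ * log (1 - x) ^ k
      = (-1) ^ k * k.factorial * ∑' n : ℕ, 1 / ((n:ℝ) + 1) ^ (k + 1) := by
  -- substitute u = 1 - x
  have h := intervalIntegral.integral_comp_sub_left (fun u : ℝ => (1 - u)⁻¹ * log u ^ k)
    (a := 0) (b := 1) 1
  simp only [sub_sub_cancel, sub_self, sub_zero] at h
  rw [h, intervalIntegral.integral_of_le zero_le_one]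
  -- termwise
  set F : ℕ → ℝ → ℝ := fun n u => u ^ n * log u ^ k with hF
  have hint : ∀ n, Integrable (F n) (volume.restrict (Ioc (0:ℝ) 1)) := fun n =>
    ((intervalIntegrable_iff_integrableOn_Ioc_of_le zero_le_one).1
      (intervalIntegrable_pow_mul_log_pow n k))
  have hFint : ∀ n, ∫ u in Ioc (0:ℝ) 1, F n u = (-1) ^ k * k.factorial / ((n:ℝ) + 1) ^ (k + 1) := by
    intro n
    rw [← intervalIntegral.integral_of_le zero_le_one]
    exact integral_pow_mul_log_pow n k
  have hsign : ∀ n, ∀ u ∈ Ioc (0:ℝ) 1, ‖F n u‖ = (-1) ^ k * F n u := by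
    intro n u hu
    simp only [hF, norm_mul, norm_pow, Real.norm_eq_abs, abs_of_pos hu.1]
    rw [abs_of_nonpos (log_nonpos hu.1.le hu.2)]
    rw [show (-log u) ^ k = (-1) ^ k * log u ^ k by rw [neg_eq_neg_one_mul, mul_pow]]
    ring
  have hnorm : ∀ n, ∫ u in Ioc (0:ℝ) 1, ‖F n u‖ = k.factorial / ((n:ℝ) + 1) ^ (k + 1) := by
    intro n
    rw [setIntegral_congr_fun measurableSet_Ioc (hsign n), MeasureTheory.integral_const_mul, hFint]
    rw [show ((-1:ℝ) ^ k * ((-1) ^ k * (k.factorial : ℝ) / ((n:ℝ) + 1) ^ (k + 1)))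
        = ((-1:ℝ) * (-1)) ^ k * ((k.factorial : ℝ) / ((n:ℝ) + 1) ^ (k + 1)) by rw [mul_pow]; ring]
    norm_num
  have hsum : Summable fun n => ∫ u in Ioc (0:ℝ) 1, ‖F n u‖ := by
    simp_rw [hnorm]
    have := ((summable_nat_add_iff 1).mpr
      (Real.summable_one_div_nat_pow.mpr (by omega : 1 < k + 1))).mul_left (k.factorial : ℝ)
    refine this.congr fun n => ?_
    push_cast
    ring
  have hmain := MeasureTheory.hasSum_integral_of_summable_integral_norm hint hsum
  -- pointwise sum
  have hpt : ∀ u ∈ Ioc (0:ℝ) 1, ∑' n, F n u = (1 - u)⁻¹ * log u ^ k := by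
    intro u hu
    rcases eq_or_lt_of_le hu.2 with h1 | h1
    · subst h1; simp [hF, zero_pow (by omega : k ≠ 0)]
    · have hg := (hasSum_geometric_of_lt_one hu.1.le h1).mul_right (log u ^ k)
      exact hg.tsum_eq
  rw [setIntegral_congr_fun measurableSet_Ioc hpt] at hmain
  have hval : HasSum (fun n => ∫ u in Ioc (0:ℝ) 1, F n u)
      ((-1) ^ k * k.factorial * ∑' n : ℕ, 1 / ((n:ℝ) + 1) ^ (k + 1)) := by
    simp_rw [hFint]
    have hs : Summable fun n : ℕ => 1 / ((n:ℝ) + 1) ^ (k + 1) := by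
      have := (summable_nat_add_iff 1).mpr
        (Real.summable_one_div_nat_pow.mpr (by omega : 1 < k + 1))
      refine this.congr fun n => ?_
      push_cast; ring
    refine (hs.hasSum.mul_left ((-1) ^ k * (k.factorial : ℝ))).congr_fun fun n => ?_
    field_simp
  exact hmain.unique hval

/-- `Σ_{n≥0} 1/(n+1)^m = ζ(m)` in the tree's notation (`zeta m = Σ' n, 1/n^m`, the `n = 0` term
being `0`). [folklore] -/
theorem tsum_inv_succ_pow_eq_zeta (m : ℕ) (hm : 2 ≤ m) :
    ∑' n : ℕ, 1 / ((n:ℝ) + 1) ^ m = zeta m := by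
  unfold zeta
  have hs : Summable fun n : ℕ => 1 / (n:ℝ) ^ m := Real.summable_one_div_nat_pow.mpr (by omega)
  rw [hs.tsum_eq_zero_add]
  have h0 : (1:ℝ) / (0:ℕ) ^ m = 0 := by simp [zero_pow (by omega : m ≠ 0)]
  rw [h0, zero_add]
  congr 1; funext n; push_cast; ring

end Summit.Ventures.QEDPrecision.BubbleChains

end
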